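import Literature.NumberTheory.LFunctions.VinogradovKorobovKernelLaplace
import Literature.NumberTheory.LFunctions.VinogradovKorobovKernelSmooth
import Literature.NumberTheory.LFunctions.VinogradovKorobovTrigIntegral
import HarnessLib

/-!
# Ford's kernel facts discharged: Lemma 4.7 of Mossinghoff–Trudgian–Yang from the zero detector and the far-zero bound alone

Topic `Literature/NumberTheory/LFunctions`. Assembly file (everything PROVED, no definition, no
named fact). The in-tree reduction of **Lemma 4.7** of Mossinghoff–Trudgian–Yang
(`zero_inequality_mossinghoff_trudgian_yang_of_ford`, `VinogradovKorobovZeroDetector.lean`) has four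
analytic hypotheses `h42`, `h44`, `h46`, `hker`. Two of them are now theorems of the tree:

* `h44` = MTY Lemma 4.4 (Ford 2002, Lemma 5.1): `mty_lemma_4_4'` (`VinogradovKorobovTrigIntegral.lean`);
* `hker` = the kernel facts `FordKernelFacts θ` for every `θ ∈ (0, π/2)`: `w = g ⋆ g ∈ C¹`
  (`FordKernelC1.contDiff_fordKernelW`, `VinogradovKorobovKernelSmooth.lean`) and the closed form
  `W(z) = w(0)/z + W₀(z)` (Ford (7.2)–(7.3) = MTY (4.4), `fordLaplaceWC_eq_closed_form`,
  `VinogradovKorobovKernelLaplace.lean`) — `fordKernelFacts` below.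

Hence `zero_inequality_mossinghoff_trudgian_yang_of_detector`: **Lemma 4.7 follows from `h42` (Ford's
smoothed zero detector, Ford Lemma 4.6 with MTY Lemma 4.3) and `h46` (the far-zero bound, MTY
Lemma 4.6) alone.**

## References

* M. J. Mossinghoff, T. S. Trudgian, A. Yang, Res. Number Theory 10 (2024) = arXiv:2212.06867,
  Lemma 4.7, (4.3)–(4.5). (`MossinghoffTrudgianYangRNT2024`)
* K. Ford, *Zero-free regions for the Riemann zeta function* (2002) = arXiv:1910.08205, Lemma 4.5,
  (7.2)–(7.3). (`Ford2002Millennium`)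
-/

noncomputable section

open Real

namespace Literature.NumberTheory.LFunctions

/-- **The kernel facts of Ford §§6–7 hold for the kernel defined in Lean**: for `0 < θ < π/2`,
`w = g ⋆ g` is `C¹` and `W(z) = w(0)/z + W₀(z)` off the poles of the closed form.
[cite: Ford2002Millennium, (7.2)–(7.3)] -/
theorem fordKernelFacts {θ : ℝ} (hθ : 0 < θ) (hθ' : θ < π / 2) : FordKernelFacts θ :=
  ⟨FordKernelC1.contDiff_fordKernelW hθ hθ', fun _ hz0 hz ↦ fordLaplaceWC_eq_closed_form hθ hθ' hz0 hz⟩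

/-- **Lemma 4.7 of Mossinghoff–Trudgian–Yang from the smoothed zero detector and the far-zero
bound** (the named fact `zero_inequality_mossinghoff_trudgian_yang`, with `h44` and `hker` of
`zero_inequality_mossinghoff_trudgian_yang_of_ford` discharged). What remains: `h42` — Ford's
Lemma 4.6 (resting on the zero detector Lemma 2.2, Lemma 3.4 [proved: `FordLogZetaIntegralBound.lean`],
Lemma 4.5, Lemmas 3.1 [proved: `ZetaLogDerivRealBound.lean`] and 3.3 [proved:
`FordZetaZeroRecipSqSum.lean`]) — and `h46` — MTY Lemma 4.6 (resting on (3.8) and MTY Lemma 4.5).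
[cite: MossinghoffTrudgianYangRNT2024, Lemma 4.7] -/
theorem zero_inequality_mossinghoff_trudgian_yang_of_detector
    (h42 : ∀ A B : ℝ, 1 < A → 0 < B → RichertBound A B → ∀ η : ℝ, 0 < η → η ≤ 1 / 2 →
      ∀ (f : ℝ → ℝ) (D : ℝ), IsFordSmoothing f η D →
        (∀ t : ℝ, 1000 ≤ t → ∀ S : ℝ, FordFarZeroSumLE t η S → FordDetectorIneq A B η f D t S) ∧
          (fordK f 1).re ≤ (fordLaplace f 0).re + 1.8 * D)
    (h46 : ∀ A B : ℝ, 1 < A → 0 < B → RichertBound A B → ∀ t η : ℝ, 10000 ≤ t → 0 < η → η ≤ 1 / 4 →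
      FordFarZeroSumLE t η (mtyFarZeroBound A B t η)) :
    zero_inequality_mossinghoff_trudgian_yang :=
  zero_inequality_mossinghoff_trudgian_yang_of_ford' h42 h46 fun _ hθ hθ' ↦ fordKernelFacts hθ hθ'

end Literature.NumberTheory.LFunctions
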